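import Summits.ABC.IUTFork.Thm311RealMmod
import Summits.ABC.IUTFork.Thm311LinkSmallKits
import Summits.ABC.IUTFork.Thm311RemarksSHE
import Literature.IUT.LogThetaLattice.StripFrameWitness
import HarnessLib

/-!
# [IUTchIII] Theorem 3.11 over real definitions, R6: the premise of record with the (iii)-objects over the REAL glue

Record-only file (D-0012) of the abc-iut cell (seat abc-iut-c312-1); TAKES NO SIDE. Sequel to R5/R7 (`Thm311RealDegreeArch`, `Thm311RealMmod`:
`Real.full_statement_honest` — the typed Theorem 3.11 `FullSituation.Statement` HOLDS OUTRIGHT at the real instantiation with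
honest log-volumes at every place, print's archimedean structure and single-place (Ind3)-images, under [IUTchI] Def. 3.1 (a)
`√−1 ∈ F` only — stated with (iii)-objects `LinkData.ofGlueRadial G Λ FM` over an ABSTRACT L6 glue `G` on a frame of universe
`0`) and to J3 (`Thm311LinkSmallKits`: `LinkData.ofKitsGlue`, the (iii)-objects over abc-iut-L6-t3's REAL glue `LatticeGlue.ofKits`
on the REAL frame `StripFrame.ofKits`, in D's signature via the small model; `FullSituation.statement_relink`).
* `Real.honestLattice` — the (i)/(ii)-data of R5's instantiation, NAMED (the record of `full_statement_honest` without its link);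
* `Real.honestLattice_partI_partII` — (i) ∧ (ii) hold for it (read off `full_statement_honest` at the L6 witness glue
  `Witness.twoGlue`/`twoLattice`, `FM := 𝟭`; the link plays no role in (i), (ii));
* **`Real.full_statement_honest_realLink`** — the typed Theorem 3.11 HOLDS for `honestLattice` equipped with the (iii)-objects
  of the REAL glue (`FullSituation.ofKitsGlue`): parts (i), (ii) AND (iii) now all refer to real objects — log-shells `K_v`,
  Pr-weighted `log μ̄` / radial `M_I`-volumes, LGP splitting monoids, fractional ideals, honest Kummer images; real prime-strip
  frame, bi-coric data, theta monoids (Prop. 2.1 (vi)) and radial data (Cor. 2.3) assembled from the [IUTchI]/[IUTchII] kits.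
  Free: the `∞κ` functor `FM` ([IUTchII] Cor. 4.7 (iii), OPEN in L6), the coric binders `archSub₀ act₀ Mmod₀ region₀ thetaDiv₀
  qroot ζ` of R5, the kit binders and abc-iut-L6's interface hypotheses `hbij hsurj hR h`.
A measurement of the typing (bi-coric strictification; LANA Rem. 8.2.1), not a verdict on print; `Cor312.Setting.Statement` is
untouched. [claim: Mochizuki2012, status: disputed] [cite: LANA2026Report, Rem. 8.2.1 p. 42]
-/

noncomputable section

open Set Function NumberField IsDedekindDomain

namespace Summit.ABC.IUTFork.Thm311.Real

open Cor312Vol CategoryTheory Literature.IUT.LogThetaLattice Literature.IUT.LogVolume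
open Literature.IUT.HodgeTheaters Literature.IUT.HodgeTheaters.PMBaseKit

universe v₅ u₅

variable {F : Type} [Field F] [NumberField F] (X : PilotData F)
  [Fintype (ArchFibre X)] (hc : ∀ w : InfinitePlace F, w.IsComplex)
  (archSub₀ : ∀ (j : (thetaIndex X).Label) (v : (thetaIndex X).V),
    Set ((logShellsDH X (analyticLogv F)).Packet j ((thetaIndex X).over v)))
  (act₀ : ∀ v : (thetaIndex X).V, v ∈ (thetaIndex X).Vbad →
    (logShellsDH X (analyticLogv F)).StarPacket v → Module.End ℚ ((logShellsDH X (analyticLogv F)).StarPacket v))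
  (Mmod₀ : ∀ j : (thetaIndex X).LabelStar, Set ((logShellsDH X (analyticLogv F)).GlobalPacket j.1))
  (region₀ : ℤ → ∀ j : (thetaIndex X).LabelStar, FinDivisor F → ∀ vQ : (thetaIndex X).VQ,
    Set ((logShellsDH X (analyticLogv F)).Packet j.1 vQ))
  (thetaDiv₀ : ℤ → ℤ → LgpDivisor F (thetaIndex X).lstar)
  (qroot : ∀ v : HeightOneSpectrum (𝓞 F), Carrier (.inr v : Place F))
  (ζ : ∀ v : HeightOneSpectrum (𝓞 F), (thetaIndex X).LabelStar → (Carrier (.inr v : Place F))ˣ)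

/-- **The (i)/(ii)-data of R5's honest real instantiation, named**: c312-5's `LatticeSituation.ofShells` over `logShellsDH` with
analytic logarithms, print's archimedean structure `archPkPrint`, honest volumes `summandPiecesPrWith (archPresentationDH …)`,
the LGP splitting monoids, print's single-place (Ind3)-images, and (c) := fractional ideals with the regions `idealRegionWith
archUnitRegion` — verbatim the record of `Real.full_statement_honest`, minus its link. [claim: Mochizuki2012, status: disputed] -/
def honestLattice : LatticeSituation (thetaIndex X) :=
  { LatticeSituation.ofShells (logShellsDH X (analyticLogv F)) F
      (archPkPrint X (analyticLogv F) stripAutDH (ismDH (analyticLogv F)) refl_mem_stripAutDH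
        (refl_mem_ismDH (analyticLogv F)))
      archSub₀
      (summandPiecesPrWith X (archPresentationDH X (analyticLogv F) hc).toLocalPieces
        (logvAnalytic_analyticLogv (F := F))).Adm
      (summandPiecesPrWith X (archPresentationDH X (analyticLogv F) hc).toLocalPieces
        (logvAnalytic_analyticLogv (F := F))).logvol
      (fun _ x _ => match x with
        | .inr v => splittingMonoidLGP X (analyticLogv F) stripAutDH (ismDH (analyticLogv F))
            refl_mem_stripAutDH (refl_mem_ismDH (analyticLogv F)) v (qroot v) (ζ v)
        | .inl _ => ∅)
      (fun _ => act₀) (fun _ => Mmod₀) region₀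
      (fun _ _ => (summandPiecesPrWith X (archPresentationDH X (analyticLogv F) hc).toLocalPieces
        (logvAnalytic_analyticLogv (F := F))).Adm)
      (fun _ _ => (summandPiecesPrWith X (archPresentationDH X (analyticLogv F) hc).toLocalPieces
        (logvAnalytic_analyticLogv (F := F))).logvol)
      (fun _ _ x _ => match x with
        | .inr v => splittingMonoidLGP X (analyticLogv F) stripAutDH (ismDH (analyticLogv F))
            refl_mem_stripAutDH (refl_mem_ismDH (analyticLogv F)) v (qroot v) (ζ v)
        | .inl _ => ∅)
      (fun _ _ => Mmod₀)
      (fun _ _ m' j vQ =>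
        (logShellsDH X (analyticLogv F)).tprodSingleImages j vQ fun v => iterImage (analyticLogv F) m' v.1)
      (fun _ _ j vQ =>
        (logShellsDH X (analyticLogv F)).tprodSingleImages j vQ fun v => shell (analyticLogv F) v.1)
      thetaDiv₀ with
    G := fun _ j => GlobalDegrees.ofIdeals (logShellsDH X (analyticLogv F)) F j
      (idealRegionWith X (archUnitRegion X hc) (logvAnalytic_analyticLogv (F := F)) j.1) }

/-- **(i) ∧ (ii) of the typed Theorem 3.11 hold for the honest real instantiation** — read off R5's `full_statement_honest`
(at the L6 witness glue `Witness.twoGlue`/`twoLattice`, `FM := 𝟭`; the (iii)-objects play no role in (i), (ii)). [folklore] -/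
theorem honestLattice_partI_partII :
    (honestLattice X hc archSub₀ act₀ Mmod₀ region₀ thetaDiv₀ qroot ζ).PartI ∧
      (honestLattice X hc archSub₀ act₀ Mmod₀ region₀ thetaDiv₀ qroot ζ).PartII := by
  have h := full_statement_honest X hc archSub₀ act₀ Mmod₀ region₀ thetaDiv₀ Witness.twoGlue Witness.twoLattice
    (𝟭 (Core Witness.twoFrame.DHT)) qroot ζ
  exact ⟨h.1, h.2.1⟩

variable {l : ℕ} {K : PMBaseKit.{0} l} {M : K.MultKit} {FK : K.FKit M} (Lk : FK.MonoLaws)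
  (hbij : FK.IsomFtoDBijective) (hsurj : FK.IsomFmtoDmSurjective) (hR : FK.RlfOfIsStrip) (Xk : TimesMuSide FK Lk)
  (h : ∀ A B : Xk.Fglxm, Function.Surjective (fun g : A ≅ B => (Xk.FglxmToFvtxm ⋙ Xk.FvtxmToFxm).mapIso g))
  (Gk : LatticeGlueKit hR Xk) (kind : LatticeKind) (Hk : ℤ × ℤ → FK.ThetaPMEllHT) (hH : Function.Injective Hk)
  {Kap : Type u₅} [Category.{v₅} Kap] [LocallySmall.{0} Kap]
  (FM : Core (StripFrame.ofKits Lk hbij hsurj hR Xk).DHT ⥤ Kap)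

/-- **THE TYPED THEOREM 3.11 HOLDS at the honest real instantiation WITH THE (iii)-OBJECTS OVER THE REAL GLUE**: the full
situation `FullSituation.ofKitsGlue … (honestLattice …)` — (i)/(ii)-data as in R5, (iii)-objects `LinkData.ofKitsGlue` over
abc-iut-L6-t3's `LatticeGlue.ofKits` on `StripFrame.ofKits` (real frame, bi-coric data, theta monoids with Prop. 2.1 (vi), radial
data of Cor. 2.3, from the [IUTchI]/[IUTchII] kits; log-theta-lattice `LatticeGlue.ofKitsDiagram` of any injective family `Hk` of
`Θ^{±ell}`-Hodge theaters) — satisfies `FullSituation.Statement`, with no hypothesis beyond `√−1 ∈ F` (`hc`) and L6's interface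
hypotheses `hbij hsurj hR h`. Free: the `∞κ` functor `FM`. A measurement of the typing; no side taken.
[claim: Mochizuki2012, status: disputed] -/
theorem full_statement_honest_realLink :
    (FullSituation.ofKitsGlue Lk hbij hsurj hR Xk h Gk kind Hk hH FM
      (honestLattice X hc archSub₀ act₀ Mmod₀ region₀ thetaDiv₀ qroot ζ)).Statement :=
  (FullSituation.ofKitsGlue_statement_iff Lk hbij hsurj hR Xk h Gk kind Hk hH FM _).2
    (honestLattice_partI_partII X hc archSub₀ act₀ Mmod₀ region₀ thetaDiv₀ qroot ζ)

/-- **… and with (c)'s number fields instantiated as well** (`Mmod₀ := Real.Mmod`, R7): every datum of the typed Theorem 3.11 that has a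
real referent in the tree is now plugged — log-shells, volumes, splitting monoids, number-field copies, global Frobenioids/regions, Kummer
images, and the (iii)-objects; the remaining binders are `archSub₀` (sub-packet structure, unused by the typed clauses), `act₀` (the
multiplicative action, used on `Ψ` only), `region₀`/`thetaDiv₀` (the Θ-pilot line bundles' regions, Cor. 3.12's business), `qroot`/`ζ`
(2l-th roots / torsion profiles of the LGP monoids) and the `∞κ` functor `FM`. [claim: Mochizuki2012, status: disputed] -/
theorem full_statement_honest_mmod_realLink :
    (FullSituation.ofKitsGlue Lk hbij hsurj hR Xk h Gk kind Hk hH FM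
      (honestLattice X hc archSub₀ act₀ (Mmod X (analyticLogv F)) region₀ thetaDiv₀ qroot ζ)).Statement :=
  full_statement_honest_realLink X hc archSub₀ act₀ (Mmod X (analyticLogv F)) region₀ thetaDiv₀ qroot ζ Lk hbij hsurj hR Xk h
    Gk kind Hk hH FM

/-- … with (IPL) and (SHE)-as-typed (F2 `FullSituation.SHETyped`: the closed loop of Rmk. 3.9.5 (ix) on the `F⊢×μ` portions and
the output reading) holding there too — the real `F⊢×μ`-prime-strip category is connected (`ofKitsGlue_ipl`) and (i) holds
(`sheTyped_of_statement_of_ipl`). [folklore] -/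
theorem realLink_ipl_sheTyped :
    (LinkData.ofKitsGlue Lk hbij hsurj hR Xk h Gk kind Hk hH FM).IPL ∧
      (FullSituation.ofKitsGlue Lk hbij hsurj hR Xk h Gk kind Hk hH FM
        (honestLattice X hc archSub₀ act₀ Mmod₀ region₀ thetaDiv₀ qroot ζ)).SHETyped :=
  ⟨LinkData.ofKitsGlue_ipl Lk hbij hsurj hR Xk h Gk kind Hk hH FM,
    FullSituation.sheTyped_of_statement_of_ipl _
      (full_statement_honest_realLink X hc archSub₀ act₀ Mmod₀ region₀ thetaDiv₀ qroot ζ Lk hbij hsurj hR Xk h Gk kind Hk hH FM)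
      (LinkData.ofKitsGlue_ipl Lk hbij hsurj hR Xk h Gk kind Hk hH FM)⟩

/-- … and the (iii)-objects there satisfy (iii)(c)(d) AS TYPED with the horizontal arrows the full poly-isomorphisms
(J3 `ofKitsGlue_partIIIc_partIIId`, `ofKitsGlue_horizontal`) — recorded next to the statement for the census. [folklore] -/
theorem realLink_partIII_structural :
    (LinkData.ofKitsGlue Lk hbij hsurj hR Xk h Gk kind Hk hH FM).PartIIIc ∧
      (LinkData.ofKitsGlue Lk hbij hsurj hR Xk h Gk kind Hk hH FM).PartIIId ∧
      ∀ n m : ℤ, (LinkData.ofKitsGlue Lk hbij hsurj hR Xk h Gk kind Hk hH FM).horizontal n m = PolyIso.full _ _ :=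
  ⟨(LinkData.ofKitsGlue_partIIIc_partIIId Lk hbij hsurj hR Xk h Gk kind Hk hH FM).1,
    (LinkData.ofKitsGlue_partIIIc_partIIId Lk hbij hsurj hR Xk h Gk kind Hk hH FM).2, fun _ _ => rfl⟩

end Summit.ABC.IUTFork.Thm311.Real

end
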